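import Literature.Computability.AlgebraicComplexity.TavenasVnWitness
import Literature.Computability.AlgebraicComplexity.ValiantClasses
import Literature.Computability.AlgebraicComplexity.RazElusiveGeneralDefinable

/-!
# Crux `SOSTau.HutchinsonMagnification` (stmt-ValiantsHypothesis-18749), line `SketchWitness`: stub W `stub_hexLiftWitness`

The level-wise Boolean-sum witness (Bürgisser 2000, Def. 2.5) for the HEX DIGIT LIFT of the Tavenas–Hutchinson family,
`P_m = Σ_{i < 16^m} C (2^{vExp (4m) i}) · Π_{j<m} y_{(j, i / 16^j % 16)}` (`vExp n i = 2 i (2^n − 1 − i)`, tree `tavenasV`):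
the TRANSCRIPT polynomial of Tavenas' landed exponent circuit `TavenasVn.vCirc (4m)` (the `2(4m)+3` bits of
`vExp (4m) (ofBits b)` from the `4m` bits `b`) times a hex selector and a magnitude selector,
`W_m(y; b, t) = VALID(vCirc (4m))(b, t) · Π_{j<m} (Σ_{h<16} y_{(j,h)} Π_{r<4} lit(bit_r h)(b_{4j+r})) · Π_l (1 + (2^{2^l} − 1) wire_l(b, t))`,
genuine variables `Fin m × Fin 16`, Boolean block `TavenasVn.BB (4m) = Fin (4m) ⊕ Fin |vCirc (4m)|`.  At a Boolean point the
transcript factor kills every `t` but the true transcript (`sum_C_eval_validPoly_mul`), whose output wires carry the bits of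
`vExp (4m) (ofBits b)` (`bwval_trueTranscript_vOut`); the hex selector is then the one-hot monomial of the digits of `b` and the
magnitude selector is `2^{vExp (4m) (ofBits b)}`; reindexing `b ↔ i < 16^m = 2^{4m}` gives `Σ_{(b,t)} W_m = P_m`.  Boolean length
`4m + |vCirc (4m)|`, complexity `≤ 60|vCirc| + 249 m + 11`, degree `≤ 3|vCirc| + 13 m + 3`, all `≤ 60 · vExpSize (4m) + 300 (m+1)`
(`size_vCirc_le`) — the registered stub, consumed by the landed level-wise assembly `isVNPFamily_of_levelwise'` in the closing
file.  Def-free: the witness and its factors are LOCAL NOTATION.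

References: P. Bürgisser, *Completeness and Reduction in Algebraic Complexity Theory* (2000), Def. 2.5, Prop. 2.20;
L. G. Valiant, STOC 1979; S. Tavenas, thèse (2014), Cor. 3.37; P. Dutta, CSR 2021 (LNCS 12730), Lemma 3.
-/

set_option linter.dupNamespace false

noncomputable section

open Finset MvPolynomial
open Literature.Computability.AlgebraicComplexity
open Literature.Computability.Complexity (Circuit)
open CircuitArith BoolGadgets DefVNP TavenasVn

namespace Summit.ValiantsHypothesis.ValiantsHypothesis.Theorems.SOSTauHutchinsonMagnification

/-! ### Local notation (no definitions): the hex digit of a bit vector, the factors of the witness, the witness -/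

-- The hex digit `j` of a bit vector `e : Fin (4m) → Bool`, as an element of `Fin 16`.
set_option quotPrecheck false in
local notation "hexDigit⟪" m ", " e ", " j "⟫" =>
  (⟨Nat.ofBits (fun r : Fin 4 => e ⟨4 * ((j : Fin m) : ℕ) + (r : ℕ), by omega⟩),
    (Nat.ofBits_lt_two_pow _).trans_eq (by norm_num)⟩ : Fin 16)

-- Hex selector factor of block `j`: `Σ_h y_{(j,h)} · Π_{r<4} lit (bit_r h) (b_{4j+r})`.
set_option quotPrecheck false in
local notation "hselFactor⟪" m ", " j "⟫" =>
  (∑ h : Fin 16, (X (Sum.inl ((j : Fin m), h)) : MvPolynomial ((Fin m × Fin 16) ⊕ BB (4 * m)) ℂ) *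
    ∏ r : Fin 4, lit (Nat.testBit (h : ℕ) (r : ℕ))
      (X (Sum.inr (Sum.inl (⟨4 * (j : ℕ) + (r : ℕ), by omega⟩ : Fin (4 * m))))))

-- The hex selector `Π_j hselFactor j`.
set_option quotPrecheck false in
local notation "hsel⟪" m "⟫" => (∏ j : Fin m, hselFactor⟪m, j⟫)

-- The factor of output bit `l`: `1 + (2^{2^l} − 1)·wire_l`.
set_option quotPrecheck false in
local notation "zFactor⟪" m ", " l "⟫" =>
  ((1 : MvPolynomial ((Fin m × Fin 16) ⊕ BB (4 * m)) ℂ) + (C ((2 : ℂ) ^ 2 ^ ((l : Fin (R (4 * m))) : ℕ)) - 1) *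
    rename Sum.inr (wirePoly (k := ℂ) (vCirc (4 * m)).size (vOut (4 * m) l)))

-- The magnitude selector `Π_l zFactor l`.
set_option quotPrecheck false in
local notation "zprod⟪" m "⟫" => (∏ l : Fin (R (4 * m)), zFactor⟪m, l⟫)

-- **The transcript witness** `W_m = VALID(vCirc (4m)) · HSEL · ZPROD`.
set_option quotPrecheck false in
local notation "witness⟪" m "⟫" =>
  (rename Sum.inr (validPoly (k := ℂ) (vCirc (4 * m))) * hsel⟪m⟫ * zprod⟪m⟫)

/-! ### Hex digits and bits -/

/-- Digit/bit dictionary: `ofBits e / 16^j % 16 = hexDigit e j`. -/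
theorem ofBits_div_pow_mod (m : ℕ) (e : Fin (4 * m) → Bool) (j : Fin m) :
    Nat.ofBits e / 16 ^ (j : ℕ) % 16 = (hexDigit⟪m, e, j⟫ : ℕ) := by
  apply Nat.eq_of_testBit_eq
  intro i
  have h16 : (16 : ℕ) ^ (j : ℕ) = 2 ^ (4 * (j : ℕ)) := by rw [pow_mul]; norm_num
  have hmod : Nat.ofBits e / 2 ^ (4 * (j : ℕ)) % 16 = Nat.ofBits e / 2 ^ (4 * (j : ℕ)) % 2 ^ 4 := by norm_num
  rw [h16, hmod, Nat.testBit_mod_two_pow, Nat.testBit_div_two_pow]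
  by_cases hi : i < 4
  · rw [decide_eq_true hi, Bool.true_and, Nat.testBit_ofBits_lt _ _ hi]
    have hlt : i + 4 * (j : ℕ) < 4 * m := by omega
    rw [Nat.testBit_ofBits_lt _ _ hlt]
    congr 1
    exact Fin.ext (by simp; omega)
  · rw [decide_eq_false hi, Bool.false_and, Nat.testBit_ofBits_ge _ _ (by omega)]

/-- The bits of `hexDigit e j` are the block bits. -/
theorem testBit_hexDigit (m : ℕ) (e : Fin (4 * m) → Bool) (j : Fin m) (r : Fin 4) :
    Nat.testBit (hexDigit⟪m, e, j⟫ : ℕ) (r : ℕ) = e ⟨4 * (j : ℕ) + (r : ℕ), by omega⟩ := by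
  dsimp only
  rw [Nat.testBit_ofBits_lt _ _ r.isLt]

/-- A hex digit is determined by its four bits. -/
theorem eq_hexDigit_iff (m : ℕ) (e : Fin (4 * m) → Bool) (j : Fin m) (h : Fin 16) :
    (∀ r : Fin 4, Nat.testBit (h : ℕ) (r : ℕ) = e ⟨4 * (j : ℕ) + (r : ℕ), by omega⟩) ↔ h = hexDigit⟪m, e, j⟫ := by
  constructor
  · intro H
    apply Fin.ext
    apply Nat.eq_of_testBit_eq
    intro i
    by_cases hi : i < 4
    · rw [H ⟨i, hi⟩, testBit_hexDigit m e j ⟨i, hi⟩]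
    · have h16 : (16 : ℕ) ≤ 2 ^ i :=
        calc (16 : ℕ) = 2 ^ 4 := by norm_num
          _ ≤ 2 ^ i := Nat.pow_le_pow_right (by norm_num) (by omega)
      rw [Nat.testBit_lt_two_pow (lt_of_lt_of_le h.isLt h16),
        Nat.testBit_lt_two_pow (lt_of_lt_of_le (Fin.isLt _) h16)]
  · rintro rfl r
    exact testBit_hexDigit m e j r

/-! ### Evaluation of the witness at Boolean points of the block -/

/-- The two presentations of a Boolean point of the block agree. -/
theorem toK_comp_sumElim (m : ℕ) (b : Fin (4 * m) → Bool) (y : Fin (vCirc (4 * m)).size → Bool) :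
    (toK ℂ ∘ Sum.elim b y) = bpt ℂ b y := by funext v; cases v <;> rfl

/-- Genuine variables are untouched by the Boolean substitution. -/
theorem aeval_φb_X_inl {m : ℕ} (e : BB (4 * m) → Bool) (v : Fin m × Fin 16) :
    aeval (φb (k := ℂ) (σ := Fin m × Fin 16) e)
      (X (Sum.inl v) : MvPolynomial ((Fin m × Fin 16) ⊕ BB (4 * m)) ℂ) = X v := by
  simp [φb]

/-- A literal at a Boolean point is an equality indicator. -/
theorem aeval_φb_lit {m : ℕ} (e : BB (4 * m) → Bool) (a : Bool) (w : BB (4 * m)) :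
    aeval (φb (k := ℂ) (σ := Fin m × Fin 16) e)
      (lit a (X (Sum.inr w) : MvPolynomial ((Fin m × Fin 16) ⊕ BB (4 * m)) ℂ)) =
      if a = e w then 1 else 0 := by
  cases a <;> cases hw : e w <;> simp [CircuitArith.lit, φb, toK, hw, map_sub]

/-- The hex selector factor at a Boolean point picks the variable of the encoded digit. -/
theorem aeval_φb_hselFactor (m : ℕ) (e : BB (4 * m) → Bool) (j : Fin m) :
    aeval (φb (k := ℂ) (σ := Fin m × Fin 16) e) hselFactor⟪m, j⟫ =
      X (j, hexDigit⟪m, (fun t => e (Sum.inl t)), j⟫) := by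
  classical
  rw [map_sum]
  have hterm : ∀ h : Fin 16, aeval (φb (k := ℂ) (σ := Fin m × Fin 16) e)
      ((X (Sum.inl (j, h)) : MvPolynomial ((Fin m × Fin 16) ⊕ BB (4 * m)) ℂ) *
        ∏ r : Fin 4, lit (Nat.testBit (h : ℕ) (r : ℕ))
          (X (Sum.inr (Sum.inl (⟨4 * (j : ℕ) + (r : ℕ), by omega⟩ : Fin (4 * m)))))) =
      if h = hexDigit⟪m, (fun t => e (Sum.inl t)), j⟫ then X (j, h) else 0 := by
    intro h
    rw [map_mul, map_prod, aeval_φb_X_inl]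
    simp only [aeval_φb_lit]
    rw [Fintype.prod_boole]
    by_cases hh : h = hexDigit⟪m, (fun t => e (Sum.inl t)), j⟫
    · rw [if_pos hh, if_pos ((eq_hexDigit_iff m (fun t => e (Sum.inl t)) j h).2 hh), mul_one]
    · rw [if_neg hh, if_neg (fun H => hh ((eq_hexDigit_iff m (fun t => e (Sum.inl t)) j h).1 H)), mul_zero]
  simp only [hterm]
  rw [Finset.sum_ite_eq' Finset.univ (hexDigit⟪m, (fun t => e (Sum.inl t)), j⟫)
    (fun h => (X (j, h) : MvPolynomial (Fin m × Fin 16) ℂ))]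
  simp

/-- The hex selector at a Boolean point is the one-hot monomial of the encoded digits. -/
theorem aeval_φb_hsel (m : ℕ) (e : BB (4 * m) → Bool) :
    aeval (φb (k := ℂ) (σ := Fin m × Fin 16) e) hsel⟪m⟫ =
      ∏ j : Fin m, X (j, hexDigit⟪m, (fun t => e (Sum.inl t)), j⟫) := by
  rw [map_prod]
  exact Finset.prod_congr rfl fun j _ => aeval_φb_hselFactor m e j

/-- The output-bit factor at a Boolean point `(b, y)`: `2^{2^l}` if the wire is on, else `1`. -/
theorem aeval_φb_zFactor (m : ℕ) (b : Fin (4 * m) → Bool) (y : Fin (vCirc (4 * m)).size → Bool)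
    (l : Fin (R (4 * m))) :
    aeval (φb (k := ℂ) (σ := Fin m × Fin 16) (Sum.elim b y)) zFactor⟪m, l⟫ =
      if bwval b y (vOut (4 * m) l) then C ((2 : ℂ) ^ 2 ^ (l : ℕ)) else 1 := by
  rw [map_add, map_one, map_mul, map_sub, map_one, MvPolynomial.aeval_C, MvPolynomial.algebraMap_eq,
    aeval_φb_rename_inr, toK_comp_sumElim, eval_wirePoly]
  cases bwval b y (vOut (4 * m) l) <;> simp [toK]

/-- The magnitude selector at a Boolean point. -/
theorem aeval_φb_zprod (m : ℕ) (b : Fin (4 * m) → Bool) (y : Fin (vCirc (4 * m)).size → Bool) :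
    aeval (φb (k := ℂ) (σ := Fin m × Fin 16) (Sum.elim b y)) zprod⟪m⟫ =
      ∏ l : Fin (R (4 * m)), (if bwval b y (vOut (4 * m) l) then C ((2 : ℂ) ^ 2 ^ (l : ℕ)) else 1) := by
  rw [map_prod]
  exact Finset.prod_congr rfl fun l _ => aeval_φb_zFactor m b y l

/-- A product of bit-selected powers `2^{2^l}` is `2^{ofBits}`. -/
theorem prod_ite_pow (m : ℕ) {R : ℕ} (c : Fin R → Bool) :
    (∏ l : Fin R, (if c l then C ((2 : ℂ) ^ 2 ^ (l : ℕ)) else 1 : MvPolynomial (Fin m × Fin 16) ℂ)) =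
      C ((2 : ℂ) ^ Nat.ofBits c) := by
  have h : ∀ l : Fin R, (if c l then C ((2 : ℂ) ^ 2 ^ (l : ℕ)) else 1 : MvPolynomial (Fin m × Fin 16) ℂ) =
      C ((2 : ℂ) ^ ((c l).toNat * 2 ^ (l : ℕ))) := by
    intro l; cases c l <;> simp
  rw [Finset.prod_congr rfl fun l _ => h l, ← map_prod, Finset.prod_pow_eq_pow_sum, ← ofBits_eq_sum]

/-- **The witness at a Boolean point** `(b, y)`: `VALID(b,y) · Π_j y_{(j, digit_j b)} · Π_l (wire_l ? 2^{2^l} : 1)`. -/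
theorem aeval_φb_witness (m : ℕ) (b : Fin (4 * m) → Bool) (y : Fin (vCirc (4 * m)).size → Bool) :
    aeval (φb (k := ℂ) (σ := Fin m × Fin 16) (Sum.elim b y)) witness⟪m⟫ =
      C (MvPolynomial.eval (bpt ℂ b y) (validPoly (vCirc (4 * m)))) *
        ((∏ j : Fin m, X (j, hexDigit⟪m, b, j⟫)) *
          ∏ l : Fin (R (4 * m)), (if bwval b y (vOut (4 * m) l) then C ((2 : ℂ) ^ 2 ^ (l : ℕ)) else 1)) := by
  rw [map_mul, map_mul, aeval_φb_rename_inr, toK_comp_sumElim, aeval_φb_hsel, aeval_φb_zprod, mul_assoc]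
  rfl

/-- **The Boolean sum of the transcript witness, in bits** (transcript collapse). -/
theorem bsum_witness_bits (m : ℕ) :
    bsum witness⟪m⟫ = ∑ b : Fin (4 * m) → Bool,
      C ((2 : ℂ) ^ vExp (4 * m) (Nat.ofBits b)) *
        ∏ j : Fin m, (X (j, hexDigit⟪m, b, j⟫) : MvPolynomial (Fin m × Fin 16) ℂ) := by
  unfold bsum
  rw [sum_BB]
  refine Finset.sum_congr rfl fun b _ => ?_
  simp only [aeval_φb_witness]
  rw [sum_C_eval_validPoly_mul (vCirc (4 * m)) (isOver_vCirc (4 * m)) b]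
  simp only [bwval_trueTranscript_vOut]
  rw [prod_ite_pow, mul_comm]
  congr 2
  rw [vExpBits, Literature.Computability.Complexity.ArithCkt.ofBits_bitsOf,
    Nat.mod_eq_of_lt (vExp_lt_two_pow_R (4 * m) b)]

/-- `16^m = 2^{4m}` reindexing: the bit-indexed sum is the hex lift. -/
theorem sum_bits_eq_hexLift (m : ℕ) :
    (∑ e : Fin (4 * m) → Bool, C ((2 : ℂ) ^ vExp (4 * m) (Nat.ofBits e)) *
        ∏ j : Fin m, (X (j, hexDigit⟪m, e, j⟫) : MvPolynomial (Fin m × Fin 16) ℂ)) =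
      ∑ i ∈ Finset.range (16 ^ m), C ((2 : ℂ) ^ vExp (4 * m) i) *
        ∏ j : Fin m, X (j, (⟨i / 16 ^ (j : ℕ) % 16, Nat.mod_lt _ (by norm_num)⟩ : Fin 16)) := by
  rw [show (16 : ℕ) ^ m = 2 ^ (4 * m) by rw [pow_mul]; norm_num, ← BoolGadgets.sum_boolVec_eq_sum_range (fun i => C ((2 : ℂ) ^ vExp (4 * m) i) *
    ∏ j : Fin m, (X (j, (⟨i / 16 ^ (j : ℕ) % 16, Nat.mod_lt _ (by norm_num)⟩ : Fin 16)) :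
      MvPolynomial (Fin m × Fin 16) ℂ))]
  refine Finset.sum_congr rfl fun e _ => ?_
  congr 1
  refine Finset.prod_congr rfl fun j _ => ?_
  congr 2
  exact Fin.ext (ofBits_div_pow_mod m e j).symm

/-- **The identity: the Boolean sum of the transcript witness is the hex digit lift of `V_{4m}`** (Valiant's `boolSum`
form, Boolean block enumerated by `Fintype.equivFin`). -/
theorem boolSum_witness (m : ℕ) :
    boolSum (rename (Sum.map id (Fintype.equivFin (BB (4 * m)))) witness⟪m⟫) =
      ∑ i ∈ Finset.range (16 ^ m), C ((2 : ℂ) ^ vExp (4 * m) i) *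
        ∏ j : Fin m, X (j, (⟨i / 16 ^ (j : ℕ) % 16, Nat.mod_lt _ (by norm_num)⟩ : Fin 16)) := by
  classical
  rw [DefVNP.boolSum_rename_equiv, bsum_witness_bits, sum_bits_eq_hexLift]

/-! ### Cost bounds: complexity and degree of the witness -/

/-- One summand of the hex selector factor has `L ≤ 13`. -/
theorem complexity_hselTerm_le (m : ℕ) (j : Fin m) (h : Fin 16) :
    complexity ((X (Sum.inl (j, h)) : MvPolynomial ((Fin m × Fin 16) ⊕ BB (4 * m)) ℂ) *
      ∏ r : Fin 4, lit (Nat.testBit (h : ℕ) (r : ℕ))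
        (X (Sum.inr (Sum.inl (⟨4 * (j : ℕ) + (r : ℕ), by omega⟩ : Fin (4 * m)))))) ≤ 13 := by
  refine (complexity_mul_le_holds _ _).trans ?_
  rw [complexity_X_holds]
  have hl : ∀ r : Fin 4, complexity (lit (Nat.testBit (h : ℕ) (r : ℕ))
      (X (Sum.inr (Sum.inl (⟨4 * (j : ℕ) + (r : ℕ), by omega⟩ : Fin (4 * m)))) :
        MvPolynomial ((Fin m × Fin 16) ⊕ BB (4 * m)) ℂ)) ≤ 2 := fun r =>
    (complexity_lit_le _ _).trans (by rw [complexity_X_holds])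
  have hp := complexity_finset_prod_le (Finset.univ : Finset (Fin 4))
    (fun r => (lit (Nat.testBit (h : ℕ) (r : ℕ))
      (X (Sum.inr (Sum.inl (⟨4 * (j : ℕ) + (r : ℕ), by omega⟩ : Fin (4 * m)))) :
        MvPolynomial ((Fin m × Fin 16) ⊕ BB (4 * m)) ℂ)))
  have hs : ∑ r : Fin 4, complexity (lit (Nat.testBit (h : ℕ) (r : ℕ))
      (X (Sum.inr (Sum.inl (⟨4 * (j : ℕ) + (r : ℕ), by omega⟩ : Fin (4 * m)))) :
        MvPolynomial ((Fin m × Fin 16) ⊕ BB (4 * m)) ℂ)) ≤ ∑ _r : Fin 4, 2 := Finset.sum_le_sum fun r _ => hl r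
  rw [Finset.sum_const, Finset.card_univ, Fintype.card_fin, smul_eq_mul] at hs
  rw [Finset.card_univ, Fintype.card_fin] at hp
  omega

/-- The hex selector factor has `L ≤ 224`. -/
theorem complexity_hselFactor_le (m : ℕ) (j : Fin m) : complexity hselFactor⟪m, j⟫ ≤ 224 := by
  refine (complexity_finset_sum_le _ _).trans ?_
  calc ∑ h : Fin 16, complexity ((X (Sum.inl (j, h)) : MvPolynomial ((Fin m × Fin 16) ⊕ BB (4 * m)) ℂ) *
        ∏ r : Fin 4, lit (Nat.testBit (h : ℕ) (r : ℕ))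
          (X (Sum.inr (Sum.inl (⟨4 * (j : ℕ) + (r : ℕ), by omega⟩ : Fin (4 * m)))))) +
        (Finset.univ : Finset (Fin 16)).card
      ≤ ∑ _h : Fin 16, 13 + (Finset.univ : Finset (Fin 16)).card :=
        Nat.add_le_add_right (Finset.sum_le_sum fun h _ => complexity_hselTerm_le m j h) _
    _ = 224 := by rw [Finset.sum_const, Finset.card_univ, Fintype.card_fin, smul_eq_mul]

/-- The hex selector has `L ≤ 225 m`. -/
theorem complexity_hsel_le (m : ℕ) : complexity hsel⟪m⟫ ≤ 225 * m := by
  refine (complexity_finset_prod_le _ _).trans ?_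
  calc ∑ j : Fin m, complexity hselFactor⟪m, j⟫ + (Finset.univ : Finset (Fin m)).card
      ≤ ∑ _j : Fin m, 224 + (Finset.univ : Finset (Fin m)).card :=
        Nat.add_le_add_right (Finset.sum_le_sum fun j _ => complexity_hselFactor_le m j) _
    _ = 225 * m := by rw [Finset.sum_const, Finset.card_univ, Fintype.card_fin, smul_eq_mul]; ring

/-- One output-bit factor has `L ≤ 2` (the constant `2^{2^l} − 1` is free). -/
theorem complexity_zFactor_le (m : ℕ) (l : Fin (R (4 * m))) : complexity zFactor⟪m, l⟫ ≤ 2 := by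
  have hC : (C ((2 : ℂ) ^ 2 ^ (l : ℕ)) - 1 : MvPolynomial ((Fin m × Fin 16) ⊕ BB (4 * m)) ℂ) =
      C ((2 : ℂ) ^ 2 ^ (l : ℕ) - 1) := by rw [map_sub, C_1]
  have h1 : complexity ((C ((2 : ℂ) ^ 2 ^ (l : ℕ)) - 1) *
      rename Sum.inr (wirePoly (k := ℂ) (vCirc (4 * m)).size (vOut (4 * m) l)) :
        MvPolynomial ((Fin m × Fin 16) ⊕ BB (4 * m)) ℂ) ≤ 1 := by
    refine (complexity_mul_le_holds _ _).trans ?_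
    rw [hC, complexity_C_holds]
    have hw := (complexity_rename_le_holds' (Sum.inr : BB (4 * m) → (Fin m × Fin 16) ⊕ BB (4 * m))
      (wirePoly (k := ℂ) (vCirc (4 * m)).size (vOut (4 * m) l)))
    rw [complexity_wirePoly] at hw
    omega
  have h2 := complexity_add_le_holds (1 : MvPolynomial ((Fin m × Fin 16) ⊕ BB (4 * m)) ℂ)
    ((C ((2 : ℂ) ^ 2 ^ (l : ℕ)) - 1) *
      rename Sum.inr (wirePoly (k := ℂ) (vCirc (4 * m)).size (vOut (4 * m) l)))
  have h3 : complexity (1 : MvPolynomial ((Fin m × Fin 16) ⊕ BB (4 * m)) ℂ) = 0 := by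
    rw [← C_1]; exact complexity_C_holds _
  omega

/-- The magnitude selector has `L ≤ 3 R(4m)`. -/
theorem complexity_zprod_le (m : ℕ) : complexity zprod⟪m⟫ ≤ 3 * R (4 * m) := by
  refine (complexity_finset_prod_le _ _).trans ?_
  calc ∑ l : Fin (R (4 * m)), complexity zFactor⟪m, l⟫ + (Finset.univ : Finset (Fin (R (4 * m)))).card
      ≤ ∑ _l : Fin (R (4 * m)), 2 + (Finset.univ : Finset (Fin (R (4 * m)))).card :=
        Nat.add_le_add_right (Finset.sum_le_sum fun l _ => complexity_zFactor_le m l) _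
    _ = 3 * R (4 * m) := by rw [Finset.sum_const, Finset.card_univ, Fintype.card_fin, smul_eq_mul]; ring

/-- **Complexity of the witness**: `≤ 60·|vCirc (4m)| + 225 m + 3 R(4m) + 2`. -/
theorem complexity_witness_le (m : ℕ) :
    complexity witness⟪m⟫ ≤ 60 * (vCirc (4 * m)).size + 225 * m + 3 * R (4 * m) + 2 := by
  have hv : complexity (rename Sum.inr (validPoly (k := ℂ) (vCirc (4 * m))) :
      MvPolynomial ((Fin m × Fin 16) ⊕ BB (4 * m)) ℂ) ≤ 60 * (vCirc (4 * m)).size :=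
    (complexity_rename_le_holds' _ _).trans (RazDefinable.complexity_validPoly_le _)
  have h1 := complexity_mul_le_holds
    (rename Sum.inr (validPoly (k := ℂ) (vCirc (4 * m))) : MvPolynomial ((Fin m × Fin 16) ⊕ BB (4 * m)) ℂ)
    hsel⟪m⟫
  have h2 := complexity_mul_le_holds
    ((rename Sum.inr (validPoly (k := ℂ) (vCirc (4 * m))) : MvPolynomial ((Fin m × Fin 16) ⊕ BB (4 * m)) ℂ) *
      hsel⟪m⟫) zprod⟪m⟫
  have h3 := complexity_hsel_le m
  have h4 := complexity_zprod_le m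
  omega

/-- The hex selector factor has degree `≤ 5`. -/
theorem totalDegree_hselFactor_le (m : ℕ) (j : Fin m) : MvPolynomial.totalDegree hselFactor⟪m, j⟫ ≤ 5 := by
  refine totalDegree_finsetSum_le fun h _ => ?_
  refine (totalDegree_mul _ _).trans ?_
  have hX := totalDegree_X_le_one' (k := ℂ) (Sum.inl (j, h) : (Fin m × Fin 16) ⊕ BB (4 * m))
  have hp := totalDegree_finsetProd (Finset.univ : Finset (Fin 4))
    (fun r => (lit (Nat.testBit (h : ℕ) (r : ℕ))
      (X (Sum.inr (Sum.inl (⟨4 * (j : ℕ) + (r : ℕ), by omega⟩ : Fin (4 * m)))) :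
        MvPolynomial ((Fin m × Fin 16) ⊕ BB (4 * m)) ℂ)))
  have hs : ∑ r : Fin 4, (lit (Nat.testBit (h : ℕ) (r : ℕ))
      (X (Sum.inr (Sum.inl (⟨4 * (j : ℕ) + (r : ℕ), by omega⟩ : Fin (4 * m)))) :
        MvPolynomial ((Fin m × Fin 16) ⊕ BB (4 * m)) ℂ)).totalDegree ≤ ∑ _r : Fin 4, 1 :=
    Finset.sum_le_sum fun r _ => (totalDegree_lit_le _ _).trans (totalDegree_X_le_one' (k := ℂ) _)
  rw [Finset.sum_const, Finset.card_univ, Fintype.card_fin, smul_eq_mul] at hs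
  omega

/-- The hex selector has degree `≤ 5 m`. -/
theorem totalDegree_hsel_le (m : ℕ) : MvPolynomial.totalDegree hsel⟪m⟫ ≤ 5 * m := by
  refine (totalDegree_finsetProd _ _).trans ?_
  calc ∑ j : Fin m, MvPolynomial.totalDegree hselFactor⟪m, j⟫ ≤ ∑ _j : Fin m, 5 :=
        Finset.sum_le_sum fun j _ => totalDegree_hselFactor_le m j
    _ = 5 * m := by rw [Finset.sum_const, Finset.card_univ, Fintype.card_fin, smul_eq_mul]; ring

/-- One output-bit factor has degree `≤ 1`. -/
theorem totalDegree_zFactor_le (m : ℕ) (l : Fin (R (4 * m))) : MvPolynomial.totalDegree zFactor⟪m, l⟫ ≤ 1 := by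
  have hC : (C ((2 : ℂ) ^ 2 ^ (l : ℕ)) - 1 : MvPolynomial ((Fin m × Fin 16) ⊕ BB (4 * m)) ℂ) =
      C ((2 : ℂ) ^ 2 ^ (l : ℕ) - 1) := by rw [map_sub, C_1]
  rw [hC]
  refine (totalDegree_add _ _).trans (max_le (by rw [totalDegree_one]; exact Nat.zero_le _) ?_)
  refine (totalDegree_mul _ _).trans ?_
  rw [totalDegree_C, zero_add]
  exact (totalDegree_rename_le _ _).trans (totalDegree_wirePoly_le _)

/-- The magnitude selector has degree `≤ R(4m)`. -/
theorem totalDegree_zprod_le (m : ℕ) : MvPolynomial.totalDegree zprod⟪m⟫ ≤ R (4 * m) := by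
  refine (totalDegree_finsetProd _ _).trans ?_
  calc ∑ l : Fin (R (4 * m)), MvPolynomial.totalDegree zFactor⟪m, l⟫ ≤ ∑ _l : Fin (R (4 * m)), 1 :=
        Finset.sum_le_sum fun l _ => totalDegree_zFactor_le m l
    _ = R (4 * m) := by rw [Finset.sum_const, Finset.card_univ, Fintype.card_fin, smul_eq_mul, mul_one]

/-- **Degree of the witness**: `≤ 3·|vCirc (4m)| + 5m + R(4m)`. -/
theorem totalDegree_witness_le (m : ℕ) :
    MvPolynomial.totalDegree witness⟪m⟫ ≤ 3 * (vCirc (4 * m)).size + 5 * m + R (4 * m) := by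
  refine (totalDegree_mul _ _).trans ?_
  refine Nat.add_le_add ((totalDegree_mul _ _).trans (Nat.add_le_add ?_ (totalDegree_hsel_le m)))
    (totalDegree_zprod_le m)
  exact (totalDegree_rename_le _ _).trans (RazDefinable.totalDegree_validPoly_le _)

/-! ### The registered stub -/

/-- **Stub W `stub_hexLiftWitness` of line `SketchWitness` (crux stmt-ValiantsHypothesis-18749).** For every level `m`
there are a Boolean length `r` (namely `4m + |vCirc (4m)|`) and a polynomial `g` (the transcript witness, Boolean block
enumerated by `Fintype.equivFin`) whose Valiant Boolean sum is the hex digit lift of `V_{4m}`, with `r`, `complexity g`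
and `deg g` all at most `60 · vExpSize (4m) + 300 (m + 1)`. -/
theorem stub_hexLiftWitness :
    ∀ m : ℕ, ∃ (r : ℕ) (g : MvPolynomial ((Fin m × Fin 16) ⊕ Fin r) ℂ),
      boolSum g = ∑ i ∈ Finset.range (16 ^ m), C ((2 : ℂ) ^ vExp (4 * m) i) *
        ∏ j : Fin m, X (j, (⟨i / 16 ^ (j : ℕ) % 16, Nat.mod_lt _ (by norm_num)⟩ : Fin 16)) ∧
      r ≤ 60 * TavenasVn.vExpSize (4 * m) + 300 * (m + 1) ∧
      complexity g ≤ 60 * TavenasVn.vExpSize (4 * m) + 300 * (m + 1) ∧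
      g.totalDegree ≤ 60 * TavenasVn.vExpSize (4 * m) + 300 * (m + 1) := by
  intro m
  have hs : (vCirc (4 * m)).size ≤ TavenasVn.vExpSize (4 * m) := size_vCirc_le (4 * m)
  have hR : R (4 * m) = 8 * m + 3 := by unfold TavenasVn.R; ring
  have hcard : Fintype.card (BB (4 * m)) = 4 * m + (vCirc (4 * m)).size := by simp [TavenasVn.BB]
  refine ⟨Fintype.card (BB (4 * m)), rename (Sum.map id (Fintype.equivFin (BB (4 * m)))) witness⟪m⟫,
    boolSum_witness m, ?_, ?_, ?_⟩
  · rw [hcard]; omega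
  · refine ((complexity_rename_le_holds' _ _).trans (complexity_witness_le m)).trans ?_
    rw [hR]; omega
  · refine ((totalDegree_rename_le _ _).trans (totalDegree_witness_le m)).trans ?_
    rw [hR]; omega

end Summit.ValiantsHypothesis.ValiantsHypothesis.Theorems.SOSTauHutchinsonMagnification

end
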